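import Summits.CriticalPhenomena.PercolationContinuityZ3.Theorems.PercNearOneGluingNoHeavyLowerTailSunflowerGradedTBernFinal
import HarnessLib

/-!
# `NoHeavyLowerTail` (crux stmt-CriticalPhenomena-4575), abstract sunflower cubic: THE TWO-LEVEL LEMMA A AT A LEAF,
# UNCONDITIONALLY (`twoLevel_union_pendant` with its `GradedTBern` hypothesis discharged by `gradedTBern_holds`)

Support file (seat `prim-ineq-prove-1` gen 69; `--supports stmt-CriticalPhenomena-4575`).  No `sorry`, no named facts, no
definitions.  Memo: run/shared/lean/prim/prim-ineq-prove-1/FINDING-GRADED-prove1-g69.md §1, §4.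

With `gradedTBern_holds` (`…SunflowerGradedTBernFinal`) the `GradedTBern` hypothesis of `twoLevel_union_pendant` / `_aSafe`
(`…SunflowerTwoLevelPendant`) is discharged: **`twoLevel_union_pendant_holds`** — for an up-set `A` not depending on `z`,
`v ≠ z`, with `A`, `delMinor v A`, `conMinor v A` safe at `p` and `μ(delMinor v A) > 0`, the two-level (spanning-tree) Lemma A
`TwoLevelLemmaA p (A ∪ {v,z open}) (A ∪ {v,z open} ∪ {z open})` holds — and **`twoLevel_union_pendant_aSafe_holds`** (from
A-safety of `A`).  This is the "pendant two-level lemma" PL(A, z) at a leaf `z` (memo FINDING-EDGE-prove1-g68 §1, §3).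
(The cycle corollaries of `…SunflowerCycleSafe` are NOT restated here: their second hypothesis `EdgeLemma` is refuted in
`…SunflowerEdgeLemmaCounterexample`.)
-/

noncomputable section

namespace Summit.CriticalPhenomena.PercolationContinuityZ3.Theorems.SunflowerPartition

namespace SafeCalc

open MeasureTheory Finset
open Literature.Probability.LatticeModels Literature.Probability.Percolation

namespace Pendant

open UnionEdge LinkedCurrency

variable {ι : Type*} [DecidableEq ι] (p : ι → unitInterval)

/-- **THE TWO-LEVEL LEMMA A AT A LEAF (fixed `p`), unconditionally.**  `A` an up-set not depending on `z`, `v ≠ z`, with `A`,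
`delMinor v A`, `conMinor v A` safe at `p` and `μ(delMinor v A) > 0`.  Then
`TwoLevelLemmaA p (A ∪ {v,z open}) (A ∪ {v,z open} ∪ {z open})`. [this work] -/
theorem twoLevel_union_pendant_holds [Fintype ι] {v z : ι} (hne : v ≠ z) {A : Set (Set ι)}
    (hd : DeterminedBy A (↑({z} : Finset ι) : Set ι)ᶜ) (hu : IsUpperSet A) (hA : Safe p A)
    (hA0 : Safe p (delMinor v A)) (hA1 : Safe p (conMinor v A)) (hpos : 0 < (prodBernoulli p).real (delMinor v A)) :
    TwoLevelLemmaA p (A ∪ pairOpen v z) (A ∪ pairOpen v z ∪ {ω | z ∈ ω}) :=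
  twoLevel_union_pendant p hne hd hu hA hA0 hA1 hpos
    (gradedTBern_holds hpos (measureReal_mono ((delMinor_subset v hu).trans (subset_conMinor v hu)))
      measureReal_le_one (p v).2.1 (p v).2.2)

/-- **The two-level Lemma A at a leaf from A-safety of `A`, unconditionally.** [this work] -/
theorem twoLevel_union_pendant_aSafe_holds [Fintype ι] {v z : ι} (hne : v ≠ z) {A : Set (Set ι)}
    (hd : DeterminedBy A (↑({z} : Finset ι) : Set ι)ᶜ) (hu : IsUpperSet A) (hA : ∀ q, Safe q A)
    (hpos : 0 < (prodBernoulli p).real (delMinor v A)) :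
    TwoLevelLemmaA p (A ∪ pairOpen v z) (A ∪ pairOpen v z ∪ {ω | z ∈ ω}) :=
  twoLevel_union_pendant_holds p hne hd hu (hA p) (aSafe_delMinor hu hA v p) (aSafe_conMinor hu hA v p) hpos

end Pendant


end SafeCalc

end Summit.CriticalPhenomena.PercolationContinuityZ3.Theorems.SunflowerPartition
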